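import Summits.BirchSwinnertonDyer.BirchSwinnertonDyer.Theorems.KolyvaginDepthDoorDepthTableKurihara
import Summits.BirchSwinnertonDyer.BirchSwinnertonDyer.Theorems.KolyvaginDepthDoorDepthTableRankTwo433a1TwistBSDQuotientUniform
import Summits.BirchSwinnertonDyer.BirchSwinnertonDyer.Theorems.Rank2Observatory433a1TwoDescClRankTwo
import Summits.BirchSwinnertonDyer.Rank1Residual.Supersingular.CountPointsFast
import Summits.BirchSwinnertonDyer.Rank1Residual.Additive.X4ThreeKuriharaCertKernel
import Literature.NumberTheory.EllipticCurves.BSDSelmerPConverseSerreProofs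
import HarnessLib

/-!
# Route `KolyvaginDepthDoor`, crux `KolyvaginDepthSupplyKN` (stmt-BirchSwinnertonDyer-22820) —
# DEPTH TABLE v17, ROW `433a1` IN THE KURIHARA CURRENCY AT `p = 7` (`d_K = −8`): the crux's clause at `433a1`
# modulo print and TWO IN-TREE KURIHARA CERTIFICATES — no numerical datum owed

Helper file of the lead prover of line `levelone` (kdd-p1 g21; `--supports stmt-BirchSwinnertonDyer-22820
--as helper`); it closes nothing and BSD is NOT proved by it.

Second curve of the table in the v17 currency (generic `cruxBody_of_kuriharaClaims_spade`,
`KolyvaginDepthDoorDepthTableKurihara`). The tree holds Kurihara records for `433a1 = [1,0,0,0,1]`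
(`KuriharaCertificates/RecordsN000431to000464.lean`, `cert_433a1`: `(5, 61·131)`, `(7, 29·113, ν = 2, δ̃ ≡ 3)`,
`(11, 661·2069)`) and for the lineage's minimal model `T₀ = [0,1,0,−1,−513]` of the Heegner twist `433a1^{(−8)}`
(`C433a1.minTwist8_smul_eq`), which IS Cremona's `27712l1` (`RecordsN027712to027805.lean`, `cert_27712l1`: `(5, 101)`,
`(7, 71, ν = 1, δ̃ ≡ 3)`, `(11, 2729)`, `(13, 2081)`). The row is instantiated at the one common prime where Kim's
Theorem 1.11 applies on both sides: `p = 7` (`p = 5` is ANOMALOUS for `433a1`, `a_5 = −4 ≡ 1`, and the twist level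
`101` has non-cyclic `5`-part `#T̃₀(𝔽₁₀₁) = 100`; at `p = 11` the E-level prime `2069` has `#Ẽ(𝔽₂₀₆₉) = 11²·17`).
Kernel side conditions decided here: `#Ẽ(𝔽₇) = 11` (`a_7 = −3`: good ordinary, non-anomalous), `ρ̄_{E,7}` onto
(semistable + `X² + 2X + 3` root-free mod `7`, `a_3 = −2`), `#Ẽ(𝔽₂₉) = 28`, `#Ẽ(𝔽₁₁₃) = 112` (`29, 113 ∈ 𝒫₁(E,7)`,
cyclic `7`-parts), `#T̃₀(𝔽₇) = 5` (`a_7(T₀) = 3`, non-anomalous; the lineage's `minTwist8_card_7`), `#T̃₀(𝔽₇₁) = 63`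
(`71 ∈ 𝒫₁(T₀,7)`, cyclic); Kodaira–Néron / ♠ at every `p ≥ 5`, `rank_ℤ E(ℚ) = 2` (kernel 2-descent
`Rank2Observatory.C433a1.mordellWeilRank_eq_two`), `N_E = 433`, Heegner data for `d_K = −8` are the lineage's. `7` is
INERT in `ℚ(√−2)`: W. Zhang's ♠ supply.

RESULT `C433a1.cruxBody_of_kuriharaClaims_7_neg8`: for EVERY imaginary quadratic `K` with `d_K = −8`, the clause of
`KolyvaginDepthSupplyKN` holds at `W = 433a1` VERBATIM, CONDITIONAL on Kim 2026 Thm. 1.11, modularity, Mazur 1978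
Cor. 4.1, W. Zhang 2014 L8.4 (1)/9.1 BY NAME and on the two record claims. Per curve; nothing class-wide (the open stub
(S♭) is untouched); BSD is NOT proved by it.

References: [Kim2022StructureSelmer] Thm. 1.11, §1.2.2; [WZhang2014] Lemma 8.4 (1), Thm. 9.1; [Mazur1978] Cor. 4.1,
Prop. 6.3 (1); [Serre1972] §4.2, §5.4 Prop. 21; [CremonaAlgorithms1997] Table 1 (433a1); [SilvermanAEC2009] VII.3.1.
-/

set_option linter.dupNamespace false

noncomputable section

open scoped Classical NumberField

namespace Summit.BirchSwinnertonDyer.BirchSwinnertonDyer.Theorems.KolyvaginDepthDoor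

open Literature.NumberTheory.EllipticCurves Literature.NumberTheory.EllipticCurves.ModularForms
  WeierstrassCurve NumberField IsDedekindDomain
open Summit.BirchSwinnertonDyer.BirchSwinnertonDyer.Theorems
open Summit.BirchSwinnertonDyer.BirchSwinnertonDyer.Rank1Residual (IntModel.frobeniusTrace_eq)
open Summit.BirchSwinnertonDyer.Rank1Residual.Supersingular (natCard_point_eq_of_countPoints countPoints_eq_of_fast)
open Summit.BirchSwinnertonDyer.Rank1Residual.Additive (card_torsion_le_of_intModel_of_card
  isKolyvaginPrime_of_intModel_of_card isKolyvaginProduct_mul)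

namespace C433a1

/-! ## Kernel point counts (`countPointsFast`) -/

/-- `#Ẽ(𝔽₇) = 11` for `E = 433a1` (`a_7 = −3`: good ordinary, non-anomalous at `7`). [cite: CremonaAlgorithms1997, Table 1 (433a1)] -/
theorem card_7 :
    Nat.card (((⟨1, 0, 0, 0, 1⟩ : WeierstrassCurve ℤ).map (Int.castRingHom (ZMod 7))).toAffine.Point) = 11 :=
  haveI : Fact (Nat.Prime 7) := ⟨by norm_num⟩
  natCard_point_eq_of_countPoints 1 0 0 0 1 7 (by norm_num) (by decide +kernel) (n := 11)
    (countPoints_eq_of_fast (by decide +kernel))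

/-- `#Ẽ(𝔽₂₉) = 28 = 7·4` (`29 ≡ 1`, `a_29 = 2 ≡ 2 (mod 7)`; cyclic `7`-part). [cite: Kim2022StructureSelmer, §1.2.2 (PDF p. 5)] -/
theorem card_29 :
    Nat.card (((⟨1, 0, 0, 0, 1⟩ : WeierstrassCurve ℤ).map (Int.castRingHom (ZMod 29))).toAffine.Point) = 28 :=
  haveI : Fact (Nat.Prime 29) := ⟨by norm_num⟩
  natCard_point_eq_of_countPoints 1 0 0 0 1 29 (by norm_num) (by decide +kernel) (n := 28)
    (countPoints_eq_of_fast (by decide +kernel))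

/-- `#Ẽ(𝔽₁₁₃) = 112 = 7·16` (`113 ≡ 1`, `a_113 = 2 ≡ 2 (mod 7)`; cyclic `7`-part). [cite: Kim2022StructureSelmer, §1.2.2 (PDF p. 5)] -/
theorem card_113 :
    Nat.card (((⟨1, 0, 0, 0, 1⟩ : WeierstrassCurve ℤ).map (Int.castRingHom (ZMod 113))).toAffine.Point) = 112 :=
  haveI : Fact (Nat.Prime 113) := ⟨by norm_num⟩
  natCard_point_eq_of_countPoints 1 0 0 0 1 113 (by norm_num) (by decide +kernel) (n := 112)
    (countPoints_eq_of_fast (by decide +kernel))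

/-- `#T̃₀(𝔽₇₁) = 63 = 7·9` for `T₀ = [0,1,0,−1,−513]` (`71 ≡ 1`, `a_71(T₀) = 9 ≡ 2 (mod 7)`; cyclic `7`-part).
[cite: Kim2022StructureSelmer, §1.2.2 (PDF p. 5)] -/
theorem minTwist8_card_71 :
    Nat.card (((⟨0, 1, 0, -1, -513⟩ : WeierstrassCurve ℤ).map (Int.castRingHom (ZMod 71))).toAffine.Point) = 63 :=
  haveI : Fact (Nat.Prime 71) := ⟨by norm_num⟩
  natCard_point_eq_of_countPoints 0 1 0 (-1) (-513) 71 (by norm_num) (by decide +kernel) (n := 63)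
    (countPoints_eq_of_fast (by decide +kernel))

/-! ## `p = 7`: admissibility and the two cyclic levels -/

/-- **`7` is good ordinary for `433a1`** (`7 ∤ 433`, `a_7 = −3`). [cite: CremonaAlgorithms1997, Table 1 (433a1)] -/
theorem goodOrdinary_7 :
    haveI := Fact.mk (by norm_num : Nat.Prime 7); haveI := isGloballyMinimal_c433a1;
    ((⟨1, 0, 0, 0, 1⟩ : WeierstrassCurve ℤ).map (Int.castRingHom ℚ)).HasGoodReductionAtPrime 7 ∧
      ¬ ((7 : ℕ) : ℤ) ∣ ((⟨1, 0, 0, 0, 1⟩ : WeierstrassCurve ℤ).map (Int.castRingHom ℚ)).frobeniusTrace 7 := by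
  haveI := Fact.mk (by norm_num : Nat.Prime 7)
  haveI := isElliptic_c433a1
  haveI := isGloballyMinimal_c433a1
  exact goodOrdinary_of_intModel_certificate intModel 7 (by decide +kernel) (n := 11) card_7 (by decide +kernel)

/-- **`ρ̄_{E,7}` is surjective for `433a1`**: semistable and `X² + 2X + 3` (`a_3 = −2`) has no root mod `7`.
[cite: Serre1972, §5.4 Prop. 21] [cite: Mazur1978, §6 Prop. 6.3 (1)] -/
theorem hasSurjectiveModNGaloisRep_7 :
    haveI := isElliptic_c433a1;
    ((⟨1, 0, 0, 0, 1⟩ : WeierstrassCurve ℤ).map (Int.castRingHom ℚ)).HasSurjectiveModNGaloisRep (7 : ℕ) := by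
  have hn : ∀ t : ZMod 7, t ^ 2 - (((3 : ℕ) : ℤ) + 1 - (6 : ℕ) : ℤ) * t + ((3 : ℕ) : ZMod 7) ≠ 0 := by
    decide +kernel
  haveI := Fact.mk (by norm_num : Nat.Prime 7)
  haveI := Fact.mk (by norm_num : Nat.Prime 3)
  haveI := isElliptic_c433a1
  haveI := isGloballyMinimal_c433a1
  exact hasSurjectiveModNGaloisRep_of_intModel_certificate intModel
    (by rw [Int.isCoprime_iff_gcd_eq_one]; decide +kernel) 7 3 (by norm_num) (by decide +kernel)
    (n := 6) card_3 hn

/-- **`7` is non-anomalous for `433a1`** (`a_7 − 1 = −4`) and for `T₀` (`a_7(T₀) − 1 = 2`). [cite: SilvermanAEC2009, VII.3 Prop. 3.1] -/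
theorem nonAnomalous_7 :
    haveI := isGloballyMinimal_c433a1; haveI := minTwist8_isGloballyMinimal; haveI := Fact.mk (by norm_num : Nat.Prime 7);
    ¬ ((7 : ℕ) : ℤ) ∣ ((⟨1, 0, 0, 0, 1⟩ : WeierstrassCurve ℤ).map (Int.castRingHom ℚ)).frobeniusTrace 7 - 1 ∧
      ¬ ((7 : ℕ) : ℤ) ∣ ((⟨0, 1, 0, -1, -513⟩ : WeierstrassCurve ℤ).map (Int.castRingHom ℚ)).frobeniusTrace 7 - 1 := by
  haveI := isElliptic_c433a1
  haveI := isGloballyMinimal_c433a1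
  haveI := minTwist8_isElliptic
  haveI := minTwist8_isGloballyMinimal
  haveI := Fact.mk (by norm_num : Nat.Prime 7)
  rw [IntModel.frobeniusTrace_eq intModel card_7, IntModel.frobeniusTrace_eq minTwist8_intModel minTwist8_card_7]
  decide

/-- **`3277 = 29·113` is a cyclic Kolyvagin level for `(433a1, 7)`** — the level of `cert_433a1` at `p = 7`.
[cite: Kim2022StructureSelmer, §1.2.2 (PDF p. 5)] -/
theorem isCyclicKolyvaginLevel_7_3277 :
    haveI := isGloballyMinimal_c433a1; haveI := Fact.mk (by norm_num : Nat.Prime 7);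
    IsCyclicKolyvaginLevel ((⟨1, 0, 0, 0, 1⟩ : WeierstrassCurve ℤ).map (Int.castRingHom ℚ)) 7 3277 := by
  haveI := isElliptic_c433a1
  haveI := isGloballyMinimal_c433a1
  haveI := Fact.mk (by norm_num : Nat.Prime 7)
  haveI : Fact (Nat.Prime 29) := ⟨by norm_num⟩
  haveI : Fact (Nat.Prime 113) := ⟨by norm_num⟩
  have h29 : Kato.IsKolyvaginPrime ((⟨1, 0, 0, 0, 1⟩ : WeierstrassCurve ℤ).map (Int.castRingHom ℚ)) 7 1 29 :=
    isKolyvaginPrime_of_intModel_of_card intModel 7 1 29 (by norm_num) (by decide +kernel) (by decide) card_29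
      (by norm_num)
  have h113 : Kato.IsKolyvaginPrime ((⟨1, 0, 0, 0, 1⟩ : WeierstrassCurve ℤ).map (Int.castRingHom ℚ)) 7 1 113 :=
    isKolyvaginPrime_of_intModel_of_card intModel 7 1 113 (by norm_num) (by decide +kernel) (by decide) card_113
      (by norm_num)
  refine ⟨by simpa using isKolyvaginProduct_mul h29 h113 (by norm_num), fun ℓ hℓ hdvd ↦ ?_⟩
  rw [show (3277 : ℕ) = 29 * 113 from rfl] at hdvd
  rcases (Nat.Prime.dvd_mul hℓ.out).mp hdvd with h | h
  · obtain rfl := (Nat.prime_dvd_prime_iff_eq hℓ.out (by norm_num)).mp h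
    exact card_torsion_le_of_intModel_of_card intModel 7 29 card_29 (by norm_num)
  · obtain rfl := (Nat.prime_dvd_prime_iff_eq hℓ.out (by norm_num)).mp h
    exact card_torsion_le_of_intModel_of_card intModel 7 113 card_113 (by norm_num)

/-- **`71` is a cyclic Kolyvagin level for `(T₀, 7)`**, `T₀ = 433a1^{(−8)} = 27712l1` — the level of `cert_27712l1` at `p = 7`.
[cite: Kim2022StructureSelmer, §1.2.2 (PDF p. 5)] -/
theorem minTwist8_isCyclicKolyvaginLevel_7_71 :
    haveI := minTwist8_isGloballyMinimal; haveI := Fact.mk (by norm_num : Nat.Prime 7);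
    IsCyclicKolyvaginLevel ((⟨0, 1, 0, -1, -513⟩ : WeierstrassCurve ℤ).map (Int.castRingHom ℚ)) 7 71 := by
  haveI := minTwist8_isElliptic
  haveI := minTwist8_isGloballyMinimal
  haveI := Fact.mk (by norm_num : Nat.Prime 7)
  haveI : Fact (Nat.Prime 71) := ⟨by norm_num⟩
  have h71 : Kato.IsKolyvaginPrime ((⟨0, 1, 0, -1, -513⟩ : WeierstrassCurve ℤ).map (Int.castRingHom ℚ)) 7 1 71 :=
    isKolyvaginPrime_of_intModel_of_card minTwist8_intModel 7 1 71 (by norm_num) (by decide +kernel) (by decide)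
      minTwist8_card_71 (by norm_num)
  refine ⟨⟨Nat.squarefree_iff_nodup_primeFactorsList (by norm_num) |>.mpr (by simp), fun ℓ hℓ ↦ ?_⟩, fun ℓ hℓ hdvd ↦ ?_⟩
  · rw [show (71 : ℕ).primeFactors = {71} from (Nat.Prime.primeFactors (by norm_num)), Finset.mem_singleton] at hℓ
    exact hℓ ▸ h71
  · obtain rfl := (Nat.prime_dvd_prime_iff_eq hℓ.out (by norm_num)).mp hdvd
    exact card_torsion_le_of_intModel_of_card minTwist8_intModel 7 71 minTwist8_card_71 (by norm_num)

/-! ## The row: the crux's clause at `433a1` from the two tree certificates (Kurihara currency, `p = 7`) -/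

/-- **DEPTH-TABLE ROW `433a1`, `(p, d_K) = (7, −8)`, v17 — THE CRUX `KolyvaginDepthSupplyKN` AT `433a1` MODULO PRINT AND
TWO IN-TREE KURIHARA CERTIFICATES.** For EVERY imaginary quadratic `K` with `d_K = −8`: granted Kim 2026 Thm. 1.11
(`hKim`), modularity (`hnf`), Mazur 1978 Cor. 4.1 (`hMaz`), W. Zhang 2014 L8.4 (1)/9.1 (`h84`) BY NAME, and the CLAIMS of
the tree records `cert_433a1` @ `(7, 29·113)` (`hδE`) and `cert_27712l1` @ `(7, 71)` (`hδT`) — read at level `N_E` resp.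
`N_T` through `KuriharaCertificates.Record.Claim` —, the clause of the crux holds at `W = 433a1` VERBATIM: witnesses
`p = 7` (good ordinary `goodOrdinary_7`, `ρ_{E,7^n}` onto from `hasSurjectiveModNGaloisRep_7` by Serre's tower theorem,
Kodaira–Néron `kodairaNeron_of_five_le 7`), that `K` (Heegner: `heegner_neg8`), W. Zhang's level-one class, first sign
(`rank E = 2`). CONDITIONAL on the four named facts and the two claims; per curve; nothing class-wide; BSD is not proved
by it. [cite: Kim2022StructureSelmer, Thm. 1.11 (PDF p. 8)] [cite: WZhang2014, Lemma 8.4 (1) (p. 236), Thm. 9.1 (p. 240)]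
[cite: Mazur1978, Cor. 4.1] [cite: Serre1972, §4.2 Thm. 2] [cite: CremonaAlgorithms1997, Table 1 (433a1)] -/
theorem cruxBody_of_kuriharaClaims_7_neg8
    (hKim : Kim2022_card_selmerGroup_le_pow_of_kuriharaNumber_ne_zero)
    (hnf : exists_isNewformOf) (hMaz : mazur_not_dvd_maninConstant_of_odd)
    (h84 : Literature.NumberTheory.EllipticCurves.WZhang2014_lemma84_exists_minimal_kolyvaginClass_one_selmerCard)
    (K : Type) [Field K] [NumberField K] (hK : IsImaginaryQuadratic K) (hD : NumberField.discr K = -8)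
    (hδE : haveI := isElliptic_c433a1; haveI := isGloballyMinimal_c433a1;
      haveI : NeZero (((⟨1, 0, 0, 0, 1⟩ : WeierstrassCurve ℤ).map (Int.castRingHom ℚ)).conductorNorm ℤ) :=
        neZero_conductorNorm_of_isElliptic _;
      haveI := Fact.mk (by norm_num : Nat.Prime 7);
      ∀ (D : ModularParametrizationData ((⟨1, 0, 0, 0, 1⟩ : WeierstrassCurve ℤ).map (Int.castRingHom ℚ))
          (((⟨1, 0, 0, 0, 1⟩ : WeierstrassCurve ℤ).map (Int.castRingHom ℚ)).conductorNorm ℤ)),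
        ¬ ((7 : ℕ) : ℤ) ∣ D.maninConstant →
        (∃ u : ℚ, ‖(u : ℚ_[7])‖ = 1 ∧
          ((⟨1, 0, 0, 0, 1⟩ : WeierstrassCurve ℤ).map (Int.castRingHom ℚ)).realPeriodRat = u * plusPeriod D.f) →
        ∃ ψ : (ℓ : ℕ) → (ZMod ℓ)ˣ →* Multiplicative (ZMod 7),
          (∀ ℓ ∈ (3277 : ℕ).primeFactors, Function.Surjective (ψ ℓ)) ∧ kuriharaNumber D.f 7 3277 ψ ≠ 0)
    (hδT : haveI := minTwist8_isElliptic; haveI := minTwist8_isGloballyMinimal;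
      haveI : NeZero (((⟨0, 1, 0, -1, -513⟩ : WeierstrassCurve ℤ).map (Int.castRingHom ℚ)).conductorNorm ℤ) :=
        neZero_conductorNorm_of_isElliptic _;
      haveI := Fact.mk (by norm_num : Nat.Prime 7);
      ∀ (D : ModularParametrizationData ((⟨0, 1, 0, -1, -513⟩ : WeierstrassCurve ℤ).map (Int.castRingHom ℚ))
          (((⟨0, 1, 0, -1, -513⟩ : WeierstrassCurve ℤ).map (Int.castRingHom ℚ)).conductorNorm ℤ)),
        ¬ ((7 : ℕ) : ℤ) ∣ D.maninConstant →
        (∃ u : ℚ, ‖(u : ℚ_[7])‖ = 1 ∧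
          ((⟨0, 1, 0, -1, -513⟩ : WeierstrassCurve ℤ).map (Int.castRingHom ℚ)).realPeriodRat = u * plusPeriod D.f) →
        ∃ ψ : (ℓ : ℕ) → (ZMod ℓ)ˣ →* Multiplicative (ZMod 7),
          (∀ ℓ ∈ (71 : ℕ).primeFactors, Function.Surjective (ψ ℓ)) ∧ kuriharaNumber D.f 7 71 ψ ≠ 0) :
    haveI := isElliptic_c433a1; haveI := isGloballyMinimal_c433a1;
    ∃ (p : ℕ) (hp : Fact p.Prime), 5 ≤ p ∧ ((⟨1, 0, 0, 0, 1⟩ : WeierstrassCurve ℤ).map (Int.castRingHom ℚ)).HasGoodReductionAtPrime p ∧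
      ¬ (p : ℤ) ∣ ((⟨1, 0, 0, 0, 1⟩ : WeierstrassCurve ℤ).map (Int.castRingHom ℚ)).frobeniusTrace p ∧
      (∀ n : ℕ, ((⟨1, 0, 0, 0, 1⟩ : WeierstrassCurve ℤ).map (Int.castRingHom ℚ)).HasSurjectiveModNGaloisRep (p ^ n : ℕ)) ∧
      (∀ v : HeightOneSpectrum (𝓞 ℚ), ((⟨1, 0, 0, 0, 1⟩ : WeierstrassCurve ℤ).map (Int.castRingHom ℚ)).HasMultiplicativeReductionAt v →
        ¬ p ∣ ((⟨1, 0, 0, 0, 1⟩ : WeierstrassCurve ℤ).map (Int.castRingHom ℚ)).ordMinimalDiscriminant v) ∧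
      ∃ (K : Type) (_ : Field K) (_ : NumberField K), IsImaginaryQuadratic K ∧
        NumberField.discr K ≠ -3 ∧ NumberField.discr K ≠ -4 ∧
        ∃ (_ : NeZero (((⟨1, 0, 0, 0, 1⟩ : WeierstrassCurve ℤ).map (Int.castRingHom ℚ)).conductorNorm ℤ)),
          SatisfiesHeegnerHypothesis (((⟨1, 0, 0, 0, 1⟩ : WeierstrassCurve ℤ).map (Int.castRingHom ℚ)).conductorNorm ℤ) K ∧
        ∃ (Dt : ModularParametrizationData ((⟨1, 0, 0, 0, 1⟩ : WeierstrassCurve ℤ).map (Int.castRingHom ℚ))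
            (((⟨1, 0, 0, 0, 1⟩ : WeierstrassCurve ℤ).map (Int.castRingHom ℚ)).conductorNorm ℤ)) (β : ℤ) (ι : K →+* ℂ) (n₁ : ℕ)
          (d : KolyvaginHeegnerData Dt β ι n₁), Squarefree n₁ ∧
          (∀ q ∈ n₁.primeFactors, Zhang2014.IsKolyvaginPrime (((⟨1, 0, 0, 0, 1⟩ : WeierstrassCurve ℤ).map (Int.castRingHom ℚ)).conductorNorm ℤ)
            ((⟨1, 0, 0, 0, 1⟩ : WeierstrassCurve ℤ).map (Int.castRingHom ℚ)) K p q) ∧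
          d.kolyvaginClass hp.out 1 ≠ 0 ∧
          (n₁.primeFactors.card + 1 ≤ ((⟨1, 0, 0, 0, 1⟩ : WeierstrassCurve ℤ).map (Int.castRingHom ℚ)).mordellWeilRank ∨
            (n₁.primeFactors.card ≤ ((⟨1, 0, 0, 0, 1⟩ : WeierstrassCurve ℤ).map (Int.castRingHom ℚ)).mordellWeilRank ∧
              n₁.primeFactors.card + 1 ≤
                (((⟨1, 0, 0, 0, 1⟩ : WeierstrassCurve ℤ).map (Int.castRingHom ℚ)).quadraticTwist (NumberField.discr K : ℚ)).mordellWeilRank)) := by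
  haveI := isElliptic_c433a1
  haveI := isGloballyMinimal_c433a1
  haveI iNZ : NeZero (((⟨1, 0, 0, 0, 1⟩ : WeierstrassCurve ℤ).map (Int.castRingHom ℚ)).conductorNorm ℤ) :=
    neZero_conductorNorm_of_isElliptic _
  haveI iP := Fact.mk (by norm_num : Nat.Prime 7)
  haveI := minTwist8_isElliptic
  haveI := minTwist8_isGloballyMinimal
  haveI iNZT : NeZero (((⟨0, 1, 0, -1, -513⟩ : WeierstrassCurve ℤ).map (Int.castRingHom ℚ)).conductorNorm ℤ) :=
    neZero_conductorNorm_of_isElliptic _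
  haveI : NeZero (3277 : ℕ) := ⟨by norm_num⟩
  haveI : NeZero (71 : ℕ) := ⟨by norm_num⟩
  have hsp := spadeOne_of_five_le 7 (by norm_num)
  have hS2 : ¬ Squarefree (((⟨1, 0, 0, 0, 1⟩ : WeierstrassCurve ℤ).map (Int.castRingHom ℚ)).conductorNorm ℤ) →
      (∃ (ℓ : ℕ) (_ : Fact ℓ.Prime), ((⟨1, 0, 0, 0, 1⟩ : WeierstrassCurve ℤ).map (Int.castRingHom ℚ)).HasMultiplicativeReductionAtPrime ℓ ∧
          ¬ 7 ∣ padicValInt ℓ ((⟨1, 0, 0, 0, 1⟩ : WeierstrassCurve ℤ).map (Int.castRingHom ℚ)).minimalDiscriminantInt) ∧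
        ∃ (ℓ₁ ℓ₂ : ℕ) (_ : Fact ℓ₁.Prime) (_ : Fact ℓ₂.Prime), ℓ₁ ≠ ℓ₂ ∧
          ((⟨1, 0, 0, 0, 1⟩ : WeierstrassCurve ℤ).map (Int.castRingHom ℚ)).HasMultiplicativeReductionAtPrime ℓ₁ ∧
          ((⟨1, 0, 0, 0, 1⟩ : WeierstrassCurve ℤ).map (Int.castRingHom ℚ)).HasMultiplicativeReductionAtPrime ℓ₂ :=
    fun hns ↦ absurd (((⟨1, 0, 0, 0, 1⟩ : WeierstrassCurve ℤ).map (Int.castRingHom ℚ)).isSemistable_iff_squarefree_conductorNorm.mp hsp.2) hns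
  have hH : SatisfiesHeegnerHypothesis (((⟨1, 0, 0, 0, 1⟩ : WeierstrassCurve ℤ).map (Int.castRingHom ℚ)).conductorNorm ℤ) K :=
    satisfiesHeegnerHypothesis_conductorNorm_of_intModel intModel K hK.1 hD heegner_neg8
  have hD3 : NumberField.discr K ≠ -3 := by rw [hD]; norm_num
  have hD4 : NumberField.discr K ≠ -4 := by rw [hD]; norm_num
  have hpD : ¬ (((7 : ℕ) : ℤ) ∣ NumberField.discr K) := by rw [hD]; decide
  have htower : ∀ k : ℕ, ((⟨1, 0, 0, 0, 1⟩ : WeierstrassCurve ℤ).map (Int.castRingHom ℚ)).HasSurjectiveModNGaloisRep (7 ^ k : ℕ) :=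
    serre_hasSurjectiveModNGaloisRep_pow_holds _ 7 (by norm_num) hasSurjectiveModNGaloisRep_7
  have hC : (⟨1, (-1 : ℚ), (0 : ℚ), (0 : ℚ)⟩ : WeierstrassCurve.VariableChange ℚ) •
      ((⟨0, 1, 0, -1, -513⟩ : WeierstrassCurve ℤ).map (Int.castRingHom ℚ)) =
      ((⟨1, 0, 0, 0, 1⟩ : WeierstrassCurve ℤ).map (Int.castRingHom ℚ)).quadraticTwist (NumberField.discr K : ℚ) := by
    rw [hD]; push_cast; exact minTwist8_smul_eq
  have hrank2 := Summit.BirchSwinnertonDyer.BirchSwinnertonDyer.Rank2Observatory.C433a1.mordellWeilRank_eq_two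
  have hrank : 2 ≤ ((⟨1, 0, 0, 0, 1⟩ : WeierstrassCurve ℤ).map (Int.castRingHom ℚ)).mordellWeilRank := hrank2.ge
  have hν : (3277 : ℕ).primeFactors.card ≤ ((⟨1, 0, 0, 0, 1⟩ : WeierstrassCurve ℤ).map (Int.castRingHom ℚ)).mordellWeilRank := by
    rw [hrank2, show (3277 : ℕ) = 29 * 113 from rfl, Nat.primeFactors_mul (by norm_num) (by norm_num),
      Nat.Prime.primeFactors (by norm_num), Nat.Prime.primeFactors (by norm_num)]
    decide
  have hμ : (71 : ℕ).primeFactors.card ≤ ((⟨1, 0, 0, 0, 1⟩ : WeierstrassCurve ℤ).map (Int.castRingHom ℚ)).mordellWeilRank := by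
    rw [hrank2, Nat.Prime.primeFactors (by norm_num), Finset.card_singleton]; omega
  exact cruxBody_of_kuriharaClaims_spade hKim hnf hMaz h84 _ hrank 7 (by norm_num) goodOrdinary_7.1 goodOrdinary_7.2 htower
    (kodairaNeron_of_five_le 7 (by norm_num)) nonAnomalous_7.1 hsp.1 hS2 K hK hD3 hD4 hpD hH
    3277 isCyclicKolyvaginLevel_7_3277 hν hδE
    ((⟨0, 1, 0, -1, -513⟩ : WeierstrassCurve ℤ).map (Int.castRingHom ℚ)) _ hC nonAnomalous_7.2
    (minTwist8_kodairaNeron_of_five_le 7 (by norm_num)) 71 minTwist8_isCyclicKolyvaginLevel_7_71 hμ hδT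

end C433a1

end Summit.BirchSwinnertonDyer.BirchSwinnertonDyer.Theorems.KolyvaginDepthDoor

end
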